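import Summits.CriticalPhenomena.PercolationContinuityZ3.Theorems.SahiMasterFamilyPointwiseCoordinateGluing
import Summits.CriticalPhenomena.PercolationContinuityZ3.Theorems.SahiMasterFamilyBernsteinGoodCoordinate

/-!
# One-coordinate gluing, II: `C_3` and the pointwise master statement are inherited from ONE minor under conjunctive pinning
# and under double disjunctive gluing

Unit `prim-master-conj` (crux anchor stmt-CriticalPhenomena-4575, helper work), gen 15; memo
`run/shared/lean/prim/prim-l12/prim-master-conj/POINTWISE.md` §16.  Companion of `…PointwiseCoordinateGluing` (the identities (A), (B)).

Call an increasing triple `V` SETTLED if at every interior parameter `E_3(μ; 1_V) ≥ 0` and `E_3(μ; 1_V) = 0 ↔ V ∈ Z_3` (spelled out inline).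
* `sahiE_three_interCoord_nonneg` / `sahiE_three_interCoord_settled` — (A): for increasing `A, B` (arbitrary dependence on `e`) and `e`-free
  increasing `C`, `C_3` at `p`, resp. settledness, passes from the `1`-minor `(A¹, B¹, C)` to `(A, B, C ∩ {e∈ω})` — triples ONE MEMBER OF WHICH
  REQUIRES THE COORDINATE `e` (`U_2 ⊆ {e∈ω}`);
* `sahiE_three_unionCoord_two_free_nonneg` / `…_settled` — (B): for increasing `A` (arbitrary) and `e`-free increasing `B, C`, from the `0`-minor
  `(A⁰, B, C)` to `(A, B ∪ {e∈ω}, C ∪ {e∈ω})` — TWO MEMBERS IMPLIED BY `e`.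
Mechanism: every piece of the identities is a nonnegative transferable atom (Harris covariance of increasing events / probability of an event /
difference of nested probabilities), so a zero at one interior `p` kills every atom at every interior `q`; `E_3 ≡ 0` on the open cube is `Z_3`
(`suppZeroFlag_of_eq_zero_on_paramBox`, i.e. (EQI-3)).  These are exactly the two "degenerate-section" shapes (a minor with an empty member / a minor
with two sure members); at `n = 4` they account for all 59 symmetry classes of triples having a coordinate with both minors in `Z_3` that no earlier
stratum covered (seat census, memo §16).  The settled class was already closed under private extension, absorbing extension, independent
intersection (gens 13–14) and P3's disjunctive closure (the case `A` `e`-free of (B)); (A) and (B) are new closure operations.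
HONEST FRAMING: inheritance theorems; Kahn's Conjecture 5 / `MasterFamilyEqIff 3` remain OPEN.  Axioms standard. [this work]
-/

noncomputable section

open scoped Classical

namespace Summit.CriticalPhenomena.PercolationContinuityZ3.Theorems

open Finset Function
open Literature.Combinatorics.Sahi2008
open Literature.Probability.Percolation.DecisionTree (ind ind_of_mem ind_of_not_mem ind_nonneg)
open SahiCombDisjunct

namespace Pointwise

variable {ι : Type} [Fintype ι]

/-! ### 3. Inheritance of `C_3` and of the pointwise statement -/

omit [Fintype ι] in
/-- The indicator family of a triple `![X, Y, W]`. [folklore] -/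
theorem ind_vec3 (X Y W : Set (Set ι)) : (fun j => ind ((![X, Y, W] : Fin 3 → Set (Set ι)) j)) = ![ind X, ind Y, ind W] := by
  funext j; fin_cases j <;> rfl

/-- **(A) `C_3` is inherited from the `1`-minor under conjunctive pinning**: for increasing `A, B, C` with `C` `e`-free,
`E_3(μ_p; A¹, B¹, C) ≥ 0 ⟹ E_3(μ_p; A, B, C ∩ {e∈ω}) ≥ 0`. [this work] -/
theorem sahiE_three_interCoord_nonneg (p : ι → unitInterval) (e : ι) {A B C : Set (Set ι)} (hA : IsUpperSet A) (hB : IsUpperSet B)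
    (hC : IsUpperSet C) (hCe : ∀ b : Bool, secAt e b C = C)
    (h1 : 0 ≤ sahiE (bernoulliWeight p) 3 (fun j => ind ((![secAt e true A, secAt e true B, C] : Fin 3 → Set (Set ι)) j))) :
    0 ≤ sahiE (bernoulliWeight p) 3 (fun j => ind ((![A, B, C ∩ {ω : Set ι | e ∈ ω}] : Fin 3 → Set (Set ι)) j)) := by
  rw [ind_vec3] at h1 ⊢
  rw [sahiE_three_interCoord_eq p e A B C hCe]
  have ht0 : 0 ≤ (p e : ℝ) := (p e).2.1
  have ht1 : 0 ≤ 1 - (p e : ℝ) := sub_nonneg.2 (p e).2.2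
  have nA := ex_secAt_true_sub_false_nonneg p e hA
  have nB := ex_secAt_true_sub_false_nonneg p e hB
  have cB := cov_ind_nonneg p (isUpperSet_secAt e true hB) hC
  have cA := cov_ind_nonneg p (isUpperSet_secAt e true hA) hC
  have mC := ex_ind_nonneg' p C
  have dAB : 0 ≤ ex (bernoulliWeight p) (ind (secAt e true A ∩ secAt e true B)) -
      ex (bernoulliWeight p) (ind (secAt e false A ∩ secAt e false B)) := by
    rw [ex_ind_sub_of_subset _ (Set.inter_subset_inter (RigidityAll.secAt_false_subset_secAt_true e hA)
      (RigidityAll.secAt_false_subset_secAt_true e hB))]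
    exact ex_ind_nonneg' p _
  have t1 := mul_nonneg ht0 h1
  have t2 := mul_nonneg (mul_nonneg ht0 ht1) (add_nonneg (add_nonneg (mul_nonneg nA cB) (mul_nonneg nB cA)) (mul_nonneg mC dAB))
  have t3 := mul_nonneg (mul_nonneg ht0 (pow_nonneg ht1 2)) (mul_nonneg mC (mul_nonneg nA nB))
  linarith

/-- **(A) the pointwise statement is inherited from the `1`-minor under conjunctive pinning.**  If `(A¹, B¹, C)` is SETTLED on the open cube
(`E_3 ≥ 0` and `E_3 = 0 ↔ Z_3` at every interior parameter), then so is `(A, B, C ∩ {e∈ω})` at every interior `p`: a zero of `E_3(μ_p; A, B, C∩{e})`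
kills every atom, each atom's vanishing is parameter-free, so `E_3` vanishes on the whole open cube and the triple is a zero flag. [this work] -/
theorem sahiE_three_interCoord_settled {p : ι → unitInterval} (hp : ∀ f, (p f : ℝ) ∈ Set.Ioo (0 : ℝ) 1) (e : ι) {A B C : Set (Set ι)}
    (hA : IsUpperSet A) (hB : IsUpperSet B) (hC : IsUpperSet C) (hCe : ∀ b : Bool, secAt e b C = C)
    (hS : ∀ r : ι → unitInterval, (∀ f, (r f : ℝ) ∈ Set.Ioo (0 : ℝ) 1) →
      0 ≤ sahiE (bernoulliWeight r) 3 (fun j => ind ((![secAt e true A, secAt e true B, C] : Fin 3 → Set (Set ι)) j)) ∧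
        (sahiE (bernoulliWeight r) 3 (fun j => ind ((![secAt e true A, secAt e true B, C] : Fin 3 → Set (Set ι)) j)) = 0 ↔
          SuppZeroFlag 3 ![secAt e true A, secAt e true B, C])) :
    0 ≤ sahiE (bernoulliWeight p) 3 (fun j => ind ((![A, B, C ∩ {ω : Set ι | e ∈ ω}] : Fin 3 → Set (Set ι)) j)) ∧
      (sahiE (bernoulliWeight p) 3 (fun j => ind ((![A, B, C ∩ {ω : Set ι | e ∈ ω}] : Fin 3 → Set (Set ι)) j)) = 0 ↔
        SuppZeroFlag 3 ![A, B, C ∩ {ω : Set ι | e ∈ ω}]) := by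
  have hU : ∀ j, IsUpperSet ((![A, B, C ∩ {ω : Set ι | e ∈ ω}] : Fin 3 → Set (Set ι)) j) := by
    intro j; fin_cases j
    · exact hA
    · exact hB
    · exact hC.inter (isUpperSet_coordEvent e)
  refine ⟨sahiE_three_interCoord_nonneg p e hA hB hC hCe (hS p hp).1, fun hz => ?_, fun hZ => masterFamilyEqIff_mpr 3 ι p _ hZ⟩
  refine suppZeroFlag_of_eq_zero_on_paramBox _ hU (a := fun _ => 0) (b := fun _ => 1) (fun _ => zero_lt_one) (fun _ => le_rfl)
    (fun _ => le_rfl) fun q hq => ?_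
  -- the atoms at `p`
  have ht0 : 0 < (p e : ℝ) := (hp e).1
  have ht1 : 0 < 1 - (p e : ℝ) := sub_pos.2 (hp e).2
  have h1 := (hS p hp).1
  rw [ind_vec3] at h1
  have nA := ex_secAt_true_sub_false_nonneg p e hA
  have nB := ex_secAt_true_sub_false_nonneg p e hB
  have cB := cov_ind_nonneg p (isUpperSet_secAt e true hB) hC
  have cA := cov_ind_nonneg p (isUpperSet_secAt e true hA) hC
  have mC := ex_ind_nonneg' p C
  have hsub : secAt e false A ∩ secAt e false B ⊆ secAt e true A ∩ secAt e true B :=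
    Set.inter_subset_inter (RigidityAll.secAt_false_subset_secAt_true e hA) (RigidityAll.secAt_false_subset_secAt_true e hB)
  have dAB : 0 ≤ ex (bernoulliWeight p) (ind (secAt e true A ∩ secAt e true B)) -
      ex (bernoulliWeight p) (ind (secAt e false A ∩ secAt e false B)) := by
    rw [ex_ind_sub_of_subset _ hsub]; exact ex_ind_nonneg' p _
  have hz' := hz
  rw [ind_vec3, sahiE_three_interCoord_eq p e A B C hCe] at hz'
  have p1 := mul_nonneg nA cB
  have p2 := mul_nonneg nB cA
  have p3 := mul_nonneg mC dAB
  have p4 := mul_nonneg mC (mul_nonneg nA nB)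
  -- the three weighted summands are `≥ 0` and sum to `0`, so each vanishes
  have w1 := mul_nonneg ht0.le h1
  have w2 := mul_nonneg (mul_nonneg ht0.le ht1.le) (add_nonneg (add_nonneg p1 p2) p3)
  have w3 := mul_nonneg (mul_nonneg ht0.le (pow_nonneg ht1.le 2)) p4
  have s1 : (p e : ℝ) * sahiE (bernoulliWeight p) 3 ![ind (secAt e true A), ind (secAt e true B), ind C] = 0 := by linarith
  have s2 : (p e : ℝ) * (1 - (p e : ℝ)) *
      ((ex (bernoulliWeight p) (ind (secAt e true A)) - ex (bernoulliWeight p) (ind (secAt e false A))) *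
          (ex (bernoulliWeight p) (ind (secAt e true B ∩ C)) - ex (bernoulliWeight p) (ind (secAt e true B)) * ex (bernoulliWeight p) (ind C))
        + (ex (bernoulliWeight p) (ind (secAt e true B)) - ex (bernoulliWeight p) (ind (secAt e false B))) *
          (ex (bernoulliWeight p) (ind (secAt e true A ∩ C)) - ex (bernoulliWeight p) (ind (secAt e true A)) * ex (bernoulliWeight p) (ind C))
        + ex (bernoulliWeight p) (ind C) *
          (ex (bernoulliWeight p) (ind (secAt e true A ∩ secAt e true B)) -
            ex (bernoulliWeight p) (ind (secAt e false A ∩ secAt e false B)))) = 0 := by linarith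
  have s3 : (p e : ℝ) * (1 - (p e : ℝ)) ^ 2 * (ex (bernoulliWeight p) (ind C) *
      ((ex (bernoulliWeight p) (ind (secAt e true A)) - ex (bernoulliWeight p) (ind (secAt e false A))) *
        (ex (bernoulliWeight p) (ind (secAt e true B)) - ex (bernoulliWeight p) (ind (secAt e false B))))) = 0 := by linarith
  have ht01 : (p e : ℝ) * (1 - (p e : ℝ)) ≠ 0 := mul_ne_zero ht0.ne' ht1.ne'
  have z1 : sahiE (bernoulliWeight p) 3 ![ind (secAt e true A), ind (secAt e true B), ind C] = 0 :=
    (mul_eq_zero.1 s1).resolve_left ht0.ne'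
  have s2' := (mul_eq_zero.1 s2).resolve_left ht01
  have s3' := (mul_eq_zero.1 s3).resolve_left (mul_ne_zero ht0.ne' (pow_ne_zero 2 ht1.ne'))
  have z2 : (ex (bernoulliWeight p) (ind (secAt e true A)) - ex (bernoulliWeight p) (ind (secAt e false A))) *
      (ex (bernoulliWeight p) (ind (secAt e true B ∩ C)) - ex (bernoulliWeight p) (ind (secAt e true B)) * ex (bernoulliWeight p) (ind C)) = 0 := by
    linarith
  have z3 : (ex (bernoulliWeight p) (ind (secAt e true B)) - ex (bernoulliWeight p) (ind (secAt e false B))) *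
      (ex (bernoulliWeight p) (ind (secAt e true A ∩ C)) - ex (bernoulliWeight p) (ind (secAt e true A)) * ex (bernoulliWeight p) (ind C)) = 0 := by
    linarith
  have z4 : ex (bernoulliWeight p) (ind C) * (ex (bernoulliWeight p) (ind (secAt e true A ∩ secAt e true B)) -
      ex (bernoulliWeight p) (ind (secAt e false A ∩ secAt e false B))) = 0 := by linarith
  have z5 : ex (bernoulliWeight p) (ind C) * ((ex (bernoulliWeight p) (ind (secAt e true A)) - ex (bernoulliWeight p) (ind (secAt e false A))) *
      (ex (bernoulliWeight p) (ind (secAt e true B)) - ex (bernoulliWeight p) (ind (secAt e false B)))) = 0 := s3'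
  -- transfer to `q`
  have T1 : sahiE (bernoulliWeight q) 3 ![ind (secAt e true A), ind (secAt e true B), ind C] = 0 := by
    have hZ : SuppZeroFlag 3 ![secAt e true A, secAt e true B, C] := (hS p hp).2.1 (by rw [ind_vec3]; exact z1)
    have := masterFamilyEqIff_mpr 3 ι q _ hZ
    rwa [ind_vec3] at this
  have T2 : (ex (bernoulliWeight q) (ind (secAt e true A)) - ex (bernoulliWeight q) (ind (secAt e false A))) *
      (ex (bernoulliWeight q) (ind (secAt e true B ∩ C)) - ex (bernoulliWeight q) (ind (secAt e true B)) * ex (bernoulliWeight q) (ind C)) = 0 := by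
    rcases mul_eq_zero.1 z2 with h | h
    · rw [ex_secAt_sub_eq_zero_transfer hp q e hA h, zero_mul]
    · rw [cov_ind_eq_zero_transfer hp q (isUpperSet_secAt e true hB) hC h, mul_zero]
  have T3 : (ex (bernoulliWeight q) (ind (secAt e true B)) - ex (bernoulliWeight q) (ind (secAt e false B))) *
      (ex (bernoulliWeight q) (ind (secAt e true A ∩ C)) - ex (bernoulliWeight q) (ind (secAt e true A)) * ex (bernoulliWeight q) (ind C)) = 0 := by
    rcases mul_eq_zero.1 z3 with h | h
    · rw [ex_secAt_sub_eq_zero_transfer hp q e hB h, zero_mul]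
    · rw [cov_ind_eq_zero_transfer hp q (isUpperSet_secAt e true hA) hC h, mul_zero]
  have T4 : ex (bernoulliWeight q) (ind C) * (ex (bernoulliWeight q) (ind (secAt e true A ∩ secAt e true B)) -
      ex (bernoulliWeight q) (ind (secAt e false A ∩ secAt e false B))) = 0 := by
    rcases mul_eq_zero.1 z4 with h | h
    · rw [ex_ind_eq_zero_transfer hp q _ h, zero_mul]
    · rw [ex_sub_eq_zero_transfer_of_subset hp q hsub h, mul_zero]
  have T5 : ex (bernoulliWeight q) (ind C) * ((ex (bernoulliWeight q) (ind (secAt e true A)) - ex (bernoulliWeight q) (ind (secAt e false A))) *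
      (ex (bernoulliWeight q) (ind (secAt e true B)) - ex (bernoulliWeight q) (ind (secAt e false B)))) = 0 := by
    rcases mul_eq_zero.1 z5 with h | h
    · rw [ex_ind_eq_zero_transfer hp q _ h, zero_mul]
    · rcases mul_eq_zero.1 h with h | h
      · rw [ex_secAt_sub_eq_zero_transfer hp q e hA h, zero_mul, mul_zero]
      · rw [ex_secAt_sub_eq_zero_transfer hp q e hB h, mul_zero, mul_zero]
  rw [ind_vec3, sahiE_three_interCoord_eq q e A B C hCe, T1, T2, T3, T4, T5]
  ring

/-- **(B) `C_3` is inherited from the `0`-minor under double disjunctive gluing**: for increasing `A, B, C` with `B, C` `e`-free,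
`E_3(μ_p; A⁰, B, C) ≥ 0 ⟹ E_3(μ_p; A, B ∪ {e∈ω}, C ∪ {e∈ω}) ≥ 0`. [this work] -/
theorem sahiE_three_unionCoord_two_free_nonneg (p : ι → unitInterval) (e : ι) {A B C : Set (Set ι)} (hA : IsUpperSet A)
    (hB : IsUpperSet B) (hC : IsUpperSet C) (hBe : ∀ b : Bool, secAt e b B = B) (hCe : ∀ b : Bool, secAt e b C = C)
    (h0 : 0 ≤ sahiE (bernoulliWeight p) 3 (fun j => ind ((![secAt e false A, B, C] : Fin 3 → Set (Set ι)) j))) :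
    0 ≤ sahiE (bernoulliWeight p) 3
      (fun j => ind ((![A, B ∪ {ω : Set ι | e ∈ ω}, C ∪ {ω : Set ι | e ∈ ω}] : Fin 3 → Set (Set ι)) j)) := by
  rw [ind_vec3] at h0 ⊢
  rw [sahiE_three_unionCoord_two_free p e A B C hBe hCe]
  have ht0 : 0 ≤ (p e : ℝ) := (p e).2.1
  have ht1 : 0 ≤ 1 - (p e : ℝ) := sub_nonneg.2 (p e).2.2
  have nA := ex_secAt_true_sub_false_nonneg p e hA
  have cB : 0 ≤ 1 - ex (bernoulliWeight p) (ind B) := by rw [one_sub_ex_ind]; exact ex_ind_nonneg' p _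
  have cC : 0 ≤ 1 - ex (bernoulliWeight p) (ind C) := by rw [one_sub_ex_ind]; exact ex_ind_nonneg' p _
  have cBC : 0 ≤ 1 - ex (bernoulliWeight p) (ind (B ∩ C)) := by rw [one_sub_ex_ind]; exact ex_ind_nonneg' p _
  have cell : 0 ≤ ex (bernoulliWeight p) (ind (secAt e false A)) - ex (bernoulliWeight p) (ind (secAt e false A ∩ B))
      - ex (bernoulliWeight p) (ind (secAt e false A ∩ C)) + ex (bernoulliWeight p) (ind (secAt e false A ∩ B ∩ C)) := by
    rw [← ex_ind_inter_compl_compl]; exact ex_ind_nonneg' p _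
  have cov : 0 ≤ ex (bernoulliWeight p) (ind (secAt e false A ∩ B ∩ C)) -
      ex (bernoulliWeight p) (ind (secAt e false A)) * ex (bernoulliWeight p) (ind (B ∩ C)) := by
    rw [Set.inter_assoc]; exact cov_ind_nonneg p (isUpperSet_secAt e false hA) (hB.inter hC)
  have t1 := mul_nonneg (pow_nonneg ht1 2) h0
  have t2 := mul_nonneg (mul_nonneg ht0 (pow_nonneg ht1 2)) (mul_nonneg (mul_nonneg nA cB) cC)
  have t3 := mul_nonneg (mul_nonneg ht0 ht1) (add_nonneg (add_nonneg (mul_nonneg nA cBC) cell) cov)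
  linarith

/-- **(B) the pointwise statement is inherited from the `0`-minor under double disjunctive gluing.**  If `(A⁰, B, C)` is SETTLED on the
open cube then so is `(A, B ∪ {e∈ω}, C ∪ {e∈ω})` at every interior `p`. [this work] -/
theorem sahiE_three_unionCoord_two_free_settled {p : ι → unitInterval} (hp : ∀ f, (p f : ℝ) ∈ Set.Ioo (0 : ℝ) 1) (e : ι)
    {A B C : Set (Set ι)} (hA : IsUpperSet A) (hB : IsUpperSet B) (hC : IsUpperSet C)
    (hBe : ∀ b : Bool, secAt e b B = B) (hCe : ∀ b : Bool, secAt e b C = C)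
    (hS : ∀ r : ι → unitInterval, (∀ f, (r f : ℝ) ∈ Set.Ioo (0 : ℝ) 1) →
      0 ≤ sahiE (bernoulliWeight r) 3 (fun j => ind ((![secAt e false A, B, C] : Fin 3 → Set (Set ι)) j)) ∧
        (sahiE (bernoulliWeight r) 3 (fun j => ind ((![secAt e false A, B, C] : Fin 3 → Set (Set ι)) j)) = 0 ↔
          SuppZeroFlag 3 ![secAt e false A, B, C])) :
    0 ≤ sahiE (bernoulliWeight p) 3 (fun j => ind ((![A, B ∪ {ω : Set ι | e ∈ ω}, C ∪ {ω : Set ι | e ∈ ω}] : Fin 3 → Set (Set ι)) j)) ∧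
      (sahiE (bernoulliWeight p) 3 (fun j => ind ((![A, B ∪ {ω : Set ι | e ∈ ω}, C ∪ {ω : Set ι | e ∈ ω}] : Fin 3 → Set (Set ι)) j)) = 0 ↔
        SuppZeroFlag 3 ![A, B ∪ {ω : Set ι | e ∈ ω}, C ∪ {ω : Set ι | e ∈ ω}]) := by
  have hU : ∀ j, IsUpperSet ((![A, B ∪ {ω : Set ι | e ∈ ω}, C ∪ {ω : Set ι | e ∈ ω}] : Fin 3 → Set (Set ι)) j) := by
    intro j; fin_cases j
    · exact hA
    · exact hB.union (isUpperSet_coordEvent e)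
    · exact hC.union (isUpperSet_coordEvent e)
  refine ⟨sahiE_three_unionCoord_two_free_nonneg p e hA hB hC hBe hCe (hS p hp).1, fun hz => ?_,
    fun hZ => masterFamilyEqIff_mpr 3 ι p _ hZ⟩
  refine suppZeroFlag_of_eq_zero_on_paramBox _ hU (a := fun _ => 0) (b := fun _ => 1) (fun _ => zero_lt_one) (fun _ => le_rfl)
    (fun _ => le_rfl) fun q hq => ?_
  have ht0 : 0 < (p e : ℝ) := (hp e).1
  have ht1 : 0 < 1 - (p e : ℝ) := sub_pos.2 (hp e).2
  have h1 := (hS p hp).1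
  rw [ind_vec3] at h1
  have nA := ex_secAt_true_sub_false_nonneg p e hA
  have cB : 0 ≤ 1 - ex (bernoulliWeight p) (ind B) := by rw [one_sub_ex_ind]; exact ex_ind_nonneg' p _
  have cC : 0 ≤ 1 - ex (bernoulliWeight p) (ind C) := by rw [one_sub_ex_ind]; exact ex_ind_nonneg' p _
  have cBC : 0 ≤ 1 - ex (bernoulliWeight p) (ind (B ∩ C)) := by rw [one_sub_ex_ind]; exact ex_ind_nonneg' p _
  have cell : 0 ≤ ex (bernoulliWeight p) (ind (secAt e false A)) - ex (bernoulliWeight p) (ind (secAt e false A ∩ B))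
      - ex (bernoulliWeight p) (ind (secAt e false A ∩ C)) + ex (bernoulliWeight p) (ind (secAt e false A ∩ B ∩ C)) := by
    rw [← ex_ind_inter_compl_compl]; exact ex_ind_nonneg' p _
  have cov : 0 ≤ ex (bernoulliWeight p) (ind (secAt e false A ∩ B ∩ C)) -
      ex (bernoulliWeight p) (ind (secAt e false A)) * ex (bernoulliWeight p) (ind (B ∩ C)) := by
    rw [Set.inter_assoc]; exact cov_ind_nonneg p (isUpperSet_secAt e false hA) (hB.inter hC)
  have hz' := hz
  rw [ind_vec3, sahiE_three_unionCoord_two_free p e A B C hBe hCe] at hz'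
  have p2 := mul_nonneg (mul_nonneg nA cB) cC
  have p3 := mul_nonneg nA cBC
  have w1 := mul_nonneg (pow_nonneg ht1.le 2) h1
  have w2 := mul_nonneg (mul_nonneg ht0.le (pow_nonneg ht1.le 2)) p2
  have w3 := mul_nonneg (mul_nonneg ht0.le ht1.le) (add_nonneg (add_nonneg p3 cell) cov)
  have s1 : (1 - (p e : ℝ)) ^ 2 * sahiE (bernoulliWeight p) 3 ![ind (secAt e false A), ind B, ind C] = 0 := by linarith
  have s2 : (p e : ℝ) * (1 - (p e : ℝ)) ^ 2 *
      ((ex (bernoulliWeight p) (ind (secAt e true A)) - ex (bernoulliWeight p) (ind (secAt e false A))) *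
        (1 - ex (bernoulliWeight p) (ind B)) * (1 - ex (bernoulliWeight p) (ind C))) = 0 := by linarith
  have s3 : (p e : ℝ) * (1 - (p e : ℝ)) *
      ((ex (bernoulliWeight p) (ind (secAt e true A)) - ex (bernoulliWeight p) (ind (secAt e false A))) *
          (1 - ex (bernoulliWeight p) (ind (B ∩ C)))
        + (ex (bernoulliWeight p) (ind (secAt e false A)) - ex (bernoulliWeight p) (ind (secAt e false A ∩ B))
            - ex (bernoulliWeight p) (ind (secAt e false A ∩ C)) + ex (bernoulliWeight p) (ind (secAt e false A ∩ B ∩ C)))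
        + (ex (bernoulliWeight p) (ind (secAt e false A ∩ B ∩ C)) -
            ex (bernoulliWeight p) (ind (secAt e false A)) * ex (bernoulliWeight p) (ind (B ∩ C)))) = 0 := by linarith
  have z1 : sahiE (bernoulliWeight p) 3 ![ind (secAt e false A), ind B, ind C] = 0 :=
    (mul_eq_zero.1 s1).resolve_left (pow_ne_zero 2 ht1.ne')
  have z2 : (ex (bernoulliWeight p) (ind (secAt e true A)) - ex (bernoulliWeight p) (ind (secAt e false A))) *
      (1 - ex (bernoulliWeight p) (ind B)) * (1 - ex (bernoulliWeight p) (ind C)) = 0 :=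
    (mul_eq_zero.1 s2).resolve_left (mul_ne_zero ht0.ne' (pow_ne_zero 2 ht1.ne'))
  have s3' := (mul_eq_zero.1 s3).resolve_left (mul_ne_zero ht0.ne' ht1.ne')
  have z3 : (ex (bernoulliWeight p) (ind (secAt e true A)) - ex (bernoulliWeight p) (ind (secAt e false A))) *
      (1 - ex (bernoulliWeight p) (ind (B ∩ C))) = 0 := by linarith
  have z4 : ex (bernoulliWeight p) (ind (secAt e false A)) - ex (bernoulliWeight p) (ind (secAt e false A ∩ B))
      - ex (bernoulliWeight p) (ind (secAt e false A ∩ C)) + ex (bernoulliWeight p) (ind (secAt e false A ∩ B ∩ C)) = 0 := by linarith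
  have z5 : ex (bernoulliWeight p) (ind (secAt e false A ∩ B ∩ C)) -
      ex (bernoulliWeight p) (ind (secAt e false A)) * ex (bernoulliWeight p) (ind (B ∩ C)) = 0 := by linarith
  have T1 : sahiE (bernoulliWeight q) 3 ![ind (secAt e false A), ind B, ind C] = 0 := by
    have hZ : SuppZeroFlag 3 ![secAt e false A, B, C] := (hS p hp).2.1 (by rw [ind_vec3]; exact z1)
    have := masterFamilyEqIff_mpr 3 ι q _ hZ
    rwa [ind_vec3] at this
  have T2 : (ex (bernoulliWeight q) (ind (secAt e true A)) - ex (bernoulliWeight q) (ind (secAt e false A))) *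
      (1 - ex (bernoulliWeight q) (ind B)) * (1 - ex (bernoulliWeight q) (ind C)) = 0 := by
    rcases mul_eq_zero.1 z2 with h | h
    · rcases mul_eq_zero.1 h with h | h
      · rw [ex_secAt_sub_eq_zero_transfer hp q e hA h, zero_mul, zero_mul]
      · rw [one_sub_ex_eq_zero_transfer hp q B h, mul_zero, zero_mul]
    · rw [one_sub_ex_eq_zero_transfer hp q C h, mul_zero]
  have T3 : (ex (bernoulliWeight q) (ind (secAt e true A)) - ex (bernoulliWeight q) (ind (secAt e false A))) *
      (1 - ex (bernoulliWeight q) (ind (B ∩ C))) = 0 := by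
    rcases mul_eq_zero.1 z3 with h | h
    · rw [ex_secAt_sub_eq_zero_transfer hp q e hA h, zero_mul]
    · rw [one_sub_ex_eq_zero_transfer hp q _ h, mul_zero]
  have T4 : ex (bernoulliWeight q) (ind (secAt e false A)) - ex (bernoulliWeight q) (ind (secAt e false A ∩ B))
      - ex (bernoulliWeight q) (ind (secAt e false A ∩ C)) + ex (bernoulliWeight q) (ind (secAt e false A ∩ B ∩ C)) = 0 := by
    rw [← ex_ind_inter_compl_compl] at z4 ⊢
    exact ex_ind_eq_zero_transfer hp q _ z4
  have T5 : ex (bernoulliWeight q) (ind (secAt e false A ∩ B ∩ C)) -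
      ex (bernoulliWeight q) (ind (secAt e false A)) * ex (bernoulliWeight q) (ind (B ∩ C)) = 0 := by
    rw [Set.inter_assoc] at z5 ⊢
    exact cov_ind_eq_zero_transfer hp q (isUpperSet_secAt e false hA) (hB.inter hC) z5
  rw [ind_vec3, sahiE_three_unionCoord_two_free q e A B C hBe hCe, T1, T2, T3, T4, T5]
  ring

/-! ### 4. Intrinsic forms: a member contained in `{e ∈ ω}`, two members containing `{e ∈ ω}` -/

omit [Fintype ι] in
/-- An event contained in `{e ∈ ω}` is its `1`-section cut back by `{e ∈ ω}`. [folklore] -/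
theorem secAt_true_inter_coordEvent_of_subset (e : ι) {X : Set (Set ι)} (h : X ⊆ {ω : Set ι | e ∈ ω}) :
    secAt e true X ∩ {ω : Set ι | e ∈ ω} = X := by
  ext ω
  simp only [Set.mem_inter_iff, mem_secAt, Set.mem_setOf_eq]
  constructor
  · rintro ⟨h1, he⟩
    rwa [forceAt_of_iff (b := true) (by simpa using he)] at h1
  · intro hω
    have he : e ∈ ω := h hω
    exact ⟨by rwa [forceAt_of_iff (b := true) (by simpa using he)], he⟩

omit [Fintype ι] in
/-- An increasing event containing `{e ∈ ω}` is its `0`-section OR-ed with `{e ∈ ω}`. [folklore] -/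
theorem secAt_false_union_coordEvent_of_superset (e : ι) {X : Set (Set ι)} (hX : IsUpperSet X) (h : {ω : Set ι | e ∈ ω} ⊆ X) :
    secAt e false X ∪ {ω : Set ι | e ∈ ω} = X := by
  ext ω
  simp only [Set.mem_union, mem_secAt, Set.mem_setOf_eq]
  constructor
  · rintro (h0 | he)
    · exact hX (by simp [forceAt]) h0
    · exact h he
  · intro hω
    by_cases he : e ∈ ω
    · exact Or.inr he
    · exact Or.inl (by rwa [forceAt_of_iff (b := false) (by simpa using he)])

/-- **(A), intrinsic form.**  If an increasing triple `U` has a member contained in the coordinate event `{e ∈ ω}` (the member REQUIRES `e`;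
here `U 2`), then settledness of the `1`-minor `(U_j^{e←1})_j` on the open cube gives settledness of `U` at every interior `p`. [this work] -/
theorem settled_of_member_subset_coordEvent {p : ι → unitInterval} (hp : ∀ f, (p f : ℝ) ∈ Set.Ioo (0 : ℝ) 1) (e : ι)
    (U : Fin 3 → Set (Set ι)) (hU : ∀ j, IsUpperSet (U j)) (h2 : U 2 ⊆ {ω : Set ι | e ∈ ω})
    (hS : ∀ r : ι → unitInterval, (∀ f, (r f : ℝ) ∈ Set.Ioo (0 : ℝ) 1) →
      0 ≤ sahiE (bernoulliWeight r) 3 (fun j => ind (secAt e true (U j))) ∧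
        (sahiE (bernoulliWeight r) 3 (fun j => ind (secAt e true (U j))) = 0 ↔ SuppZeroFlag 3 (fun j => secAt e true (U j)))) :
    0 ≤ sahiE (bernoulliWeight p) 3 (fun j => ind (U j)) ∧
      (sahiE (bernoulliWeight p) 3 (fun j => ind (U j)) = 0 ↔ SuppZeroFlag 3 U) := by
  obtain ⟨A, B, D, rfl⟩ : ∃ A B D : Set (Set ι), U = ![A, B, D] := ⟨U 0, U 1, U 2, by funext j; fin_cases j <;> rfl⟩
  have hA : IsUpperSet A := hU 0
  have hB : IsUpperSet B := hU 1
  have hD : IsUpperSet D := hU 2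
  have h2' : D ⊆ {ω : Set ι | e ∈ ω} := h2
  have e1 : (fun j => ind (secAt e true ((![A, B, D] : Fin 3 → Set (Set ι)) j))) =
      (fun j => ind ((![secAt e true A, secAt e true B, secAt e true D] : Fin 3 → Set (Set ι)) j)) := by
    funext j; fin_cases j <;> rfl
  have e2 : (fun j => secAt e true ((![A, B, D] : Fin 3 → Set (Set ι)) j)) = ![secAt e true A, secAt e true B, secAt e true D] := by
    funext j; fin_cases j <;> rfl
  have hS' : ∀ r : ι → unitInterval, (∀ f, (r f : ℝ) ∈ Set.Ioo (0 : ℝ) 1) →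
      0 ≤ sahiE (bernoulliWeight r) 3 (fun j => ind ((![secAt e true A, secAt e true B, secAt e true D] : Fin 3 → Set (Set ι)) j)) ∧
        (sahiE (bernoulliWeight r) 3 (fun j => ind ((![secAt e true A, secAt e true B, secAt e true D] : Fin 3 → Set (Set ι)) j)) = 0 ↔
          SuppZeroFlag 3 ![secAt e true A, secAt e true B, secAt e true D]) := by
    intro r hr
    have h := hS r hr
    rw [e1, e2] at h
    exact h
  have hCe : ∀ b : Bool, secAt e b (secAt e true D) = secAt e true D := fun b => secAt_secAt_same e b true D
  have key := sahiE_three_interCoord_settled hp e hA hB (isUpperSet_secAt e true hD) hCe hS'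
  have e3 : (![A, B, secAt e true D ∩ {ω : Set ι | e ∈ ω}] : Fin 3 → Set (Set ι)) = ![A, B, D] := by
    rw [secAt_true_inter_coordEvent_of_subset e h2']
  rw [e3] at key
  exact key

/-- **(B), intrinsic form.**  If two members of an increasing triple `U` contain the coordinate event `{e ∈ ω}` (they are IMPLIED by `e`;
here `U 1, U 2`), then settledness of the `0`-minor `(U_j^{e←0})_j` on the open cube gives settledness of `U` at every interior `p`. [this work] -/
theorem settled_of_coordEvent_subset_two_members {p : ι → unitInterval} (hp : ∀ f, (p f : ℝ) ∈ Set.Ioo (0 : ℝ) 1) (e : ι)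
    (U : Fin 3 → Set (Set ι)) (hU : ∀ j, IsUpperSet (U j)) (h1 : {ω : Set ι | e ∈ ω} ⊆ U 1) (h2 : {ω : Set ι | e ∈ ω} ⊆ U 2)
    (hS : ∀ r : ι → unitInterval, (∀ f, (r f : ℝ) ∈ Set.Ioo (0 : ℝ) 1) →
      0 ≤ sahiE (bernoulliWeight r) 3 (fun j => ind (secAt e false (U j))) ∧
        (sahiE (bernoulliWeight r) 3 (fun j => ind (secAt e false (U j))) = 0 ↔ SuppZeroFlag 3 (fun j => secAt e false (U j)))) :
    0 ≤ sahiE (bernoulliWeight p) 3 (fun j => ind (U j)) ∧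
      (sahiE (bernoulliWeight p) 3 (fun j => ind (U j)) = 0 ↔ SuppZeroFlag 3 U) := by
  obtain ⟨A, B, D, rfl⟩ : ∃ A B D : Set (Set ι), U = ![A, B, D] := ⟨U 0, U 1, U 2, by funext j; fin_cases j <;> rfl⟩
  have hA : IsUpperSet A := hU 0
  have hB : IsUpperSet B := hU 1
  have hD : IsUpperSet D := hU 2
  have h1' : {ω : Set ι | e ∈ ω} ⊆ B := h1
  have h2' : {ω : Set ι | e ∈ ω} ⊆ D := h2
  have e1 : (fun j => ind (secAt e false ((![A, B, D] : Fin 3 → Set (Set ι)) j))) =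
      (fun j => ind ((![secAt e false A, secAt e false B, secAt e false D] : Fin 3 → Set (Set ι)) j)) := by
    funext j; fin_cases j <;> rfl
  have e2 : (fun j => secAt e false ((![A, B, D] : Fin 3 → Set (Set ι)) j)) = ![secAt e false A, secAt e false B, secAt e false D] := by
    funext j; fin_cases j <;> rfl
  have hS' : ∀ r : ι → unitInterval, (∀ f, (r f : ℝ) ∈ Set.Ioo (0 : ℝ) 1) →
      0 ≤ sahiE (bernoulliWeight r) 3 (fun j => ind ((![secAt e false A, secAt e false B, secAt e false D] : Fin 3 → Set (Set ι)) j)) ∧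
        (sahiE (bernoulliWeight r) 3 (fun j => ind ((![secAt e false A, secAt e false B, secAt e false D] : Fin 3 → Set (Set ι)) j)) = 0 ↔
          SuppZeroFlag 3 ![secAt e false A, secAt e false B, secAt e false D]) := by
    intro r hr
    have h := hS r hr
    rw [e1, e2] at h
    exact h
  have hBe : ∀ b : Bool, secAt e b (secAt e false B) = secAt e false B := fun b => secAt_secAt_same e b false B
  have hDe : ∀ b : Bool, secAt e b (secAt e false D) = secAt e false D := fun b => secAt_secAt_same e b false D
  have key := sahiE_three_unionCoord_two_free_settled hp e hA (isUpperSet_secAt e false hB) (isUpperSet_secAt e false hD) hBe hDe hS'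
  have e3 : (![A, secAt e false B ∪ {ω : Set ι | e ∈ ω}, secAt e false D ∪ {ω : Set ι | e ∈ ω}] : Fin 3 → Set (Set ι)) = ![A, B, D] := by
    rw [secAt_false_union_coordEvent_of_superset e hB h1', secAt_false_union_coordEvent_of_superset e hD h2']
  rw [e3] at key
  exact key

end Pointwise

end Summit.CriticalPhenomena.PercolationContinuityZ3.Theorems
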